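import Summits.Ventures.HodgeRepro2.T7SupportWeightTorusOrbital

/-!
# The integrated form of a unitary representation, and its adjoint (support, seat p1)

For a unitary representation `π` of a group `G` on a Hilbert space `H` (`IsUnitaryRep π`, the definition of
`T7SupportWeightTorusOrbital`) that is strongly measurable, and an integrable `f` on `G` (a measure `μ`),

  `R(f) x := ∫_G f(g) • π(g) x dμ(g)`   (`integratedForm`; a bounded operator of norm `≤ ‖f‖₁`,
  `integratedFormCLM`)

satisfies, for an inversion-invariant `μ` (unimodular `G`),

  `⟪R(f) x, y⟫ = ⟪x, R(f*) y⟫`,   `f*(g) := conj f(g⁻¹)`   (`inner_integratedForm_eq`),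

so that **`R(f)` is self-adjoint when `f* = f`** (`isSelfAdjoint_integratedFormCLM`) — the hypothesis of the
finite-rank formula `T7SupportFiniteRankSelfAdjoint.apply_eq_sum` (t7-crit-1's clean form of the spectral kernel,
STATUS l. 15006 R2: `f_{ι_j} = conj⟨π₀(·) v, v⟩` and a symmetric `f_fin` give `f* = f`). Proof: `⟪∫ F, y⟫ = ∫ ⟪F g, y⟫`
(`integral_inner` through `inner_conj_symm` / `integral_conj`), unitarity `⟪π(g) x, y⟫ = ⟪x, π(g⁻¹) y⟫`, and the
substitution `g ↦ g⁻¹` (`integral_inv_eq_self`).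

Nothing here is about any specific group, any automorphic form, or any period.
Blind lane: Mathlib + the HodgeRepro2 prefix only; no sorry; axioms ⊆ {propext, Classical.choice, Quot.sound}.
-/

namespace Summit.Ventures.HodgeRepro2.T7SupportIntegratedForm

open MeasureTheory Filter
open scoped InnerProductSpace
open T7SupportWeightTorusOrbital

variable {G : Type*} [Group G] [MeasurableSpace G] (μ : Measure G) {H : Type*} [NormedAddCommGroup H]
  [InnerProductSpace ℂ H] [CompleteSpace H]

/-- the adjoint function `f*(g) = conj f(g⁻¹)` -/
def adjointFn (f : G → ℂ) (g : G) : ℂ := (starRingEnd ℂ) (f g⁻¹)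

/-- strong measurability of a representation: `g ↦ π(g) x` is a.e.-strongly measurable for every `x` -/
def IsStronglyMeasurable (π : G →* (H →ₗ[ℂ] H)) : Prop := ∀ x : H, AEStronglyMeasurable (fun g => π g x) μ

/-- the integrated form `R(f) x = ∫ f(g) • π(g) x` -/
noncomputable def integratedForm (π : G →* (H →ₗ[ℂ] H)) (f : G → ℂ) (x : H) : H :=
  ∫ g, f g • π g x ∂μ

omit [MeasurableSpace G] [CompleteSpace H] in
/-- a unitary `π` preserves norms -/
theorem norm_apply {π : G →* (H →ₗ[ℂ] H)} (hπ : IsUnitaryRep π) (g : G) (x : H) : ‖π g x‖ = ‖x‖ := by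
  have h := hπ g x x
  rw [inner_self_eq_norm_sq_to_K, inner_self_eq_norm_sq_to_K] at h
  have h' : (‖π g x‖ ^ 2 : ℝ) = ‖x‖ ^ 2 := by exact_mod_cast h
  exact (sq_eq_sq₀ (norm_nonneg _) (norm_nonneg _)).1 h'

omit [MeasurableSpace G] [CompleteSpace H] in
/-- unitarity as an adjoint relation: `⟪π(g) x, y⟫ = ⟪x, π(g⁻¹) y⟫` -/
theorem inner_apply_left {π : G →* (H →ₗ[ℂ] H)} (hπ : IsUnitaryRep π) (g : G) (x y : H) :
    ⟪π g x, y⟫_ℂ = ⟪x, π g⁻¹ y⟫_ℂ := by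
  have := hπ g x (π g⁻¹ y)
  rw [apply_inv_apply] at this
  exact this

omit [CompleteSpace H] in
/-- **integrability of the integrand** for `f` integrable and `π` unitary, strongly measurable -/
theorem integrable_smul {π : G →* (H →ₗ[ℂ] H)} (hπ : IsUnitaryRep π) (hm : IsStronglyMeasurable μ π)
    {f : G → ℂ} (hf : Integrable f μ) (x : H) : Integrable (fun g => f g • π g x) μ := by
  refine Integrable.mono' (hf.norm.mul_const ‖x‖) (hf.1.smul (hm x)) (Eventually.of_forall fun g => ?_)
  rw [norm_smul, norm_apply hπ]

/-- `⟪R(f) x, y⟫ = ∫ conj f(g) ⟪π(g) x, y⟫` -/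
theorem inner_integratedForm_left {π : G →* (H →ₗ[ℂ] H)} (hπ : IsUnitaryRep π) (hm : IsStronglyMeasurable μ π)
    {f : G → ℂ} (hf : Integrable f μ) (x y : H) :
    ⟪integratedForm μ π f x, y⟫_ℂ = ∫ g, (starRingEnd ℂ) (f g) * ⟪π g x, y⟫_ℂ ∂μ := by
  unfold integratedForm
  rw [← inner_conj_symm, ← integral_inner (integrable_smul μ hπ hm hf x) y, ← integral_conj]
  congr 1
  funext g
  rw [inner_smul_right, map_mul, inner_conj_symm]

/-- `⟪x, R(f) y⟫ = ∫ f(g) ⟪x, π(g) y⟫` -/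
theorem inner_integratedForm_right {π : G →* (H →ₗ[ℂ] H)} (hπ : IsUnitaryRep π) (hm : IsStronglyMeasurable μ π)
    {f : G → ℂ} (hf : Integrable f μ) (x y : H) :
    ⟪x, integratedForm μ π f y⟫_ℂ = ∫ g, f g * ⟪x, π g y⟫_ℂ ∂μ := by
  unfold integratedForm
  rw [← integral_inner (integrable_smul μ hπ hm hf y) x]
  congr 1
  funext g
  rw [inner_smul_right]

/-- **the adjoint of the integrated form is the integrated form of `f*`** (inversion-invariant `μ`):
`⟪R(f) x, y⟫ = ⟪x, R(f*) y⟫`. -/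
theorem inner_integratedForm_eq [MeasurableInv G] [μ.IsInvInvariant] {π : G →* (H →ₗ[ℂ] H)}
    (hπ : IsUnitaryRep π) (hm : IsStronglyMeasurable μ π) {f : G → ℂ} (hf : Integrable f μ)
    (hf' : Integrable (adjointFn f) μ) (x y : H) :
    ⟪integratedForm μ π f x, y⟫_ℂ = ⟪x, integratedForm μ π (adjointFn f) y⟫_ℂ := by
  rw [inner_integratedForm_left μ hπ hm hf, inner_integratedForm_right μ hπ hm hf']
  -- substitute `g ↦ g⁻¹` on the right
  rw [← integral_inv_eq_self (fun g => adjointFn f g * ⟪x, π g y⟫_ℂ) μ]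
  congr 1
  funext g
  unfold adjointFn
  rw [inv_inv, inner_apply_left hπ g x y]

/-! ### The integrated form as a bounded operator -/

omit [CompleteSpace H] in
/-- the integrated form is linear in `x` -/
theorem integratedForm_add {π : G →* (H →ₗ[ℂ] H)} (hπ : IsUnitaryRep π) (hm : IsStronglyMeasurable μ π)
    {f : G → ℂ} (hf : Integrable f μ) (x y : H) :
    integratedForm μ π f (x + y) = integratedForm μ π f x + integratedForm μ π f y := by
  unfold integratedForm
  simp_rw [map_add, smul_add]
  exact integral_add (integrable_smul μ hπ hm hf x) (integrable_smul μ hπ hm hf y)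

omit [CompleteSpace H] in
/-- the integrated form commutes with scalars -/
theorem integratedForm_smul (π : G →* (H →ₗ[ℂ] H)) (f : G → ℂ) (c : ℂ) (x : H) :
    integratedForm μ π f (c • x) = c • integratedForm μ π f x := by
  unfold integratedForm
  simp_rw [map_smul, smul_comm (f _) c]
  exact integral_smul c _

omit [CompleteSpace H] in
/-- **the bound `‖R(f) x‖ ≤ ‖f‖₁ ‖x‖`** -/
theorem norm_integratedForm_le {π : G →* (H →ₗ[ℂ] H)} (hπ : IsUnitaryRep π) (f : G → ℂ) (x : H) :
    ‖integratedForm μ π f x‖ ≤ (∫ g, ‖f g‖ ∂μ) * ‖x‖ := by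
  unfold integratedForm
  refine (norm_integral_le_integral_norm _).trans ?_
  have e : ∀ g, ‖f g • π g x‖ = ‖f g‖ * ‖x‖ := fun g => by rw [norm_smul, norm_apply hπ]
  simp_rw [e]
  rw [integral_mul_const]

/-- the integrated form as a linear map -/
noncomputable def integratedFormLM {π : G →* (H →ₗ[ℂ] H)} (hπ : IsUnitaryRep π) (hm : IsStronglyMeasurable μ π)
    {f : G → ℂ} (hf : Integrable f μ) : H →ₗ[ℂ] H where
  toFun := integratedForm μ π f
  map_add' := integratedForm_add μ hπ hm hf
  map_smul' := integratedForm_smul μ π f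

/-- **the integrated form as a bounded operator** (norm `≤ ‖f‖₁`) -/
noncomputable def integratedFormCLM {π : G →* (H →ₗ[ℂ] H)} (hπ : IsUnitaryRep π) (hm : IsStronglyMeasurable μ π)
    {f : G → ℂ} (hf : Integrable f μ) : H →L[ℂ] H :=
  (integratedFormLM μ hπ hm hf).mkContinuous (∫ g, ‖f g‖ ∂μ) (norm_integratedForm_le μ hπ f)

omit [CompleteSpace H] in
/-- the bounded operator acts as the integrated form -/
theorem integratedFormCLM_apply {π : G →* (H →ₗ[ℂ] H)} (hπ : IsUnitaryRep π) (hm : IsStronglyMeasurable μ π)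
    {f : G → ℂ} (hf : Integrable f μ) (x : H) : integratedFormCLM μ hπ hm hf x = integratedForm μ π f x :=
  rfl

/-- **`R(f)` is self-adjoint when `f* = f`** (inversion-invariant `μ`) -/
theorem isSelfAdjoint_integratedFormCLM [MeasurableInv G] [μ.IsInvInvariant] {π : G →* (H →ₗ[ℂ] H)}
    (hπ : IsUnitaryRep π) (hm : IsStronglyMeasurable μ π) {f : G → ℂ} (hf : Integrable f μ)
    (hsym : adjointFn f = f) : IsSelfAdjoint (integratedFormCLM μ hπ hm hf) := by
  rw [ContinuousLinearMap.isSelfAdjoint_iff']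
  symm
  rw [ContinuousLinearMap.eq_adjoint_iff]
  intro x y
  rw [integratedFormCLM_apply, integratedFormCLM_apply,
    inner_integratedForm_eq μ hπ hm hf (by rw [hsym]; exact hf) x y, hsym]

end Summit.Ventures.HodgeRepro2.T7SupportIntegratedForm
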